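import Literature.NumberTheory.Automorphic.ArthurClozelFibres
import Literature.NumberTheory.Automorphic.AutomorphicTwistNorm
import Literature.NumberTheory.Automorphic.AutomorphicRepDataSplitCenter
import Literature.NumberTheory.Automorphic.TunnellLemma
import Literature.NumberTheory.Automorphic.AutomorphicLFunctionFlathProofs
import HarnessLib

/-!
# Arthur–Clozel, Ch. 3, Thm. 3.1 for Borel–Jacquet data: the named fact
# `ArthurClozel_fibres_quadratic` from the standard leaves

Topic `NumberTheory/Automorphic`. The named fact `ArthurClozel_fibres_quadratic` of `TunnellLemma`
(Arthur–Clozel 1989, Ch. 3, Thm. 3.1 for a quadratic extension `M/K`, at the level of Hecke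
matrices, for cuspidal automorphic representations of `GL_n(𝔸_K)` in the Borel–Jacquet model
`CuspidalAutomorphicRepData n K hK` — arbitrary central characters) is **proved here from the
standard leaves of the tree**: Jacquet–Shalika (2.1)–(2.3) (`JacquetShalika1981_multipliable_partialPairL`,
`…_at_one_of_ne_conj`, `…_boundary_of_ne_one`, `…_pole_of_eq_conj`), multiplicity one on
`L²_cusp(GL_n)` (`multiplicity_one_gl`), Artin reciprocity for characters
(`artinReciprocity_character`, for the quadratic character `η_{M/K}`), and the Borel–Jacquet
dictionary between the datum model and `L²` (`exists_isAutomorphicMeasure_gl`,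
`AutomorphicRepsGL.exists_isAssociatedL2`, `hasSatakeParamAt_iff_L2`, `cuspidal_W'_eq_bot`):

* `CuspidalAutomorphicRepData.HasSatakeParamAt.of_compl` — a cuspidal datum and its realisation on
  a complement of `W'` have the same Satake parameters;
* `CuspidalAutomorphicRepData.exists_satake_eq_cpow_mul_L2` — **"We may assume `π` unitary"**
  (Arthur–Clozel, proof of Thm. 3.1; Borel–Jacquet 1979, 5.7): every cuspidal datum `π` (`n ≥ 1`)
  has, at almost every place, the Satake parameters `q_w^{s} t_{P,w}` of an `s`-shift of a cuspidal
  `P ⊂ L²_cusp(GL_n(K) A_G \ GL_n(𝔸_K))` — realise `π` on a subspace (`cuspidal_W'_eq_bot`), let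
  `A_G` act by `a ↦ a^μ` (`AutomorphicRepData.exists_apply_posRealScalar_mul_eq_cpow`), twist by
  `|det|_𝔸^{s}`, `s = -μ/(n[K:ℚ])` (`AutomorphicTwistNorm`), which is `A_G`-invariant, pass to `L²`
  (`exists_isAssociatedL2`, `hasSatakeParamAt_iff_L2`) and untwist the Satake parameters
  (`t_{π ⊗ |det|^s} = q^{-s} t_π`);
* `ArthurClozel_fibres_quadratic_of_normalisation` — **the fact**, by
  `ArthurClozel_fibres_quadratic_L2_of_shift_of_character` applied to the two unitary normalisations
  (taken as a hypothesis `hN`; `re s = re s'` by `re_eq_zero_of_map_pow_eq_shift`, the imaginary shift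
  is forced to vanish) and transport back; `n = 0` directly;
* `ArthurClozel_fibres_quadratic_of_leaves` — the same with `hN` supplied by
  `exists_satake_eq_cpow_mul_L2` from the dictionary leaves (`exists_isAssociatedL2`,
  `hasSatakeParamAt_iff_L2`, `cuspidal_W'_eq_bot` — the last one is refuted in the tree,
  `AutomorphicRepsGLLogDetCounterexample`, so this older form is vacuous; see `ArthurClozelFibresHolds`
  for the live form).

So `ArthurClozel_fibres_quadratic` is no longer an independent leaf of the Langlands–Tunnell cone:
`ArthurClozel_fibres_quadratic_holds` will follow from the discharges of the `L²` leaves and of the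
normalisation `hN` (see `ArthurClozelFibresHolds`, which feeds the leaves proved so far).

## References

* J. Arthur, L. Clozel, *Simple algebras, base change, and the advanced theory of the trace
  formula*, Ann. of Math. Stud. 120 (1989), Ch. 3, Thm. 3.1 and its proof (p. 201) [ArthurClozelAMS120].
* A. Borel, H. Jacquet, *Automorphic forms and automorphic representations*, Proc. Sympos. Pure
  Math. 33 (1979), part 1, §4.6, 5.7 [BorelJacquetCorvallis1979].
-/

noncomputable section

open scoped MatrixGroups NNReal Classical
open NumberField IsDedekindDomain MeasureTheory Filter

namespace Literature.NumberTheory.Automorphic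

open AdelicGroupData
open Literature.NumberTheory.GaloisRepresentations (HeckeCharacter ideleGroup)

variable {n : ℕ} {K : Type} [Field K] [NumberField K] {hcpt : isCompact_glFiniteIntegralLevel n K}

/-! ### Satake parameters of a datum and of its clean realisation -/

/-- **A cuspidal datum and its realisation on a complement of `W'` have the same Satake
parameters**: if `π₀ = W₀ / ⊥` with `W₀ ⊓ W' = ⊥`, `W₀ ⊔ W' = W` (`cuspidal_W'_eq_bot`), a Hecke
eigenform of `π₀` (a non-zero `φ ∈ W₀`, eigen on the nose) is a Hecke eigenform of `π` modulo `W'`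
(`φ ∉ W'` as `W₀ ⊓ W' = ⊥`). [folklore] -/
theorem AutomorphicRepData.HasSatakeParamAt.of_compl
    {π π₀ : AutomorphicRepData (AutomorphyDatum.gl n K hcpt)} (h0 : π₀.W' = ⊥)
    (hinf : π₀.W ⊓ π.W' = ⊥) (hsup : π₀.W ⊔ π.W' = π.W) {v : HeightOneSpectrum (𝓞 K)}
    {α : Multiset ℂ} (h : π₀.HasSatakeParamAt v α) : π.HasSatakeParamAt v α := by
  obtain ⟨𝔫, ϖ, h𝔫, hv𝔫, hϖ, hcard, φ, hφW, hφW', hfix, hT⟩ := h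
  refine ⟨𝔫, ϖ, h𝔫, hv𝔫, hϖ, hcard, φ, ?_, fun hφ' => ?_, hfix, fun i hi => ?_⟩
  · rw [← hsup]; exact Submodule.mem_sup_left hφW
  · have : φ ∈ π₀.W ⊓ π.W' := ⟨hφW, hφ'⟩
    rw [hinf, Submodule.mem_bot] at this
    exact hφW' (this ▸ Submodule.zero_mem _)
  · have := hT i hi
    rw [h0, Submodule.mem_bot] at this
    rw [this]
    exact Submodule.zero_mem _

/-! ### "We may assume `π` unitary": the Satake parameters of a cuspidal datum are a shift of those
of a cuspidal `L²`-representation -/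

/-- **Unitary normalisation of a cuspidal automorphic representation** (Borel–Jacquet 1979, 5.7:
"`π = π₀ ⊗ |det|^s` with `π₀` unitary"; Arthur–Clozel 1989, Ch. 3, proof of Thm. 3.1: "We may assume
`π, π'` unitary"). For a cuspidal Borel–Jacquet datum `π` on `GL_n(𝔸_K)` (`n ≥ 1`) there are
`s ∈ ℂ`, a cuspidal `P ⊂ L²_cusp(GL_n(K) A_G \ GL_n(𝔸_K))` and a Satake family `α_P` of `P` off a
finite `S` such that, for `w ∉ S`, the Satake parameters of `π` at `w` are exactly `q_w^{s} α_P(w)`.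
Granting the Borel–Jacquet dictionary (`exists_isAssociatedL2`, `hasSatakeParamAt_iff_L2`,
`cuspidal_W'_eq_bot` — named facts): realise `π` on `W₀` (`W₀' = ⊥`), on which `A_G` acts by
`a ↦ a^μ`; then `W₀ · |det|^{s}`, `s = -μ/(n[K:ℚ])`, is an `A_G`-invariant cuspidal datum
(`mulChar_detTwist_apply_posRealScalar_mul_of_cpow`), associated with some `P`, whose Satake
parameters are those of `P`; untwisting by `|det|^{-s}` multiplies them by `q_w^{s}`
(`HasSatakeParamAt.of_map_mulChar_detTwist_of_cpow`), and `π₀`, `π` have the same parameters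
(`HasSatakeParamAt.of_compl`), unique (`hasSatakeParamAt_unique_holds`).
[cite: BorelJacquetCorvallis1979, 5.7] -/
theorem CuspidalAutomorphicRepData.exists_satake_eq_cpow_mul_L2 [NeZero n]
    {μm : Measure (gl n K).automorphicQuotient} [(gl n K).IsAutomorphicMeasure μm]
    (hA : AutomorphicRepsGL.exists_isAssociatedL2 hcpt μm) (hL2 : hasSatakeParamAt_iff_L2 hcpt μm)
    (hcl : cuspidal_W'_eq_bot hcpt) (π : CuspidalAutomorphicRepData n K hcpt) :
    ∃ (s : ℂ) (P : CuspidalAutomorphicRepGL n K μm) (S : Set (HeightOneSpectrum (𝓞 K)))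
      (αP : SatakeFamily K), S.Finite ∧ IsSatakeFamilyOf P S αP ∧
      ∀ w ∉ S, ∀ β : Multiset ℂ,
        π.1.HasSatakeParamAt w β ↔ β = (αP w).map (((w.residueCard : ℂ) ^ s) * ·) := by
  -- clean realisation and its `A_G`-character
  obtain ⟨π₀, h0W', h0inf, h0sup⟩ := hcl π
  obtain ⟨μ, hμ⟩ := π₀.1.exists_apply_posRealScalar_mul_eq_cpow h0W'
  -- the normalising exponent `s₀ = -μ / (n [K:ℚ])` and the character `|·|^{s₀}`
  have hnd : ((n * Module.finrank ℚ K : ℕ) : ℂ) ≠ 0 := by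
    exact_mod_cast (Nat.mul_ne_zero (NeZero.ne n) Module.finrank_pos.ne')
  set s₀ : ℂ := -μ / (n * Module.finrank ℚ K : ℕ) with hs₀
  have hs : s₀ * (n * Module.finrank ℚ K : ℕ) = -μ := by rw [hs₀, div_mul_cancel₀ _ hnd]
  obtain ⟨χ, hχ⟩ := exists_heckeCharacter_ideleNorm_cpow K s₀
  -- the twisted datum `π₁ = π₀ ⊗ |det|^{s₀}`, `A_G`-invariant
  obtain ⟨π₁, h1W, h1W'⟩ := exists_cuspidalAutomorphicRepData_map_mulChar_detTwist hχ π₀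
  have hAG : ∀ φ ∈ π₁.1.W, ∀ z ∈ (gl n K).center', ∀ g, φ (z * g) = φ g := by
    intro φ hφ z hz g
    rw [h1W] at hφ
    obtain ⟨φ₀, hφ₀, rfl⟩ := hφ
    obtain ⟨t, rfl⟩ := hz
    exact mulChar_detTwist_apply_posRealScalar_mul_of_cpow hχ hs (hμ φ₀ hφ₀) t g
  -- pass to `L²`
  obtain ⟨P, hP⟩ := hA π₁ hAG
  obtain ⟨S, αP, -, hαP⟩ := exists_isSatakeFamilyOf_holds (n := n) (K := K) (μ := μm) P
  refine ⟨s₀, P, S, αP, S.finite_toSet, hαP, fun w hw β => ?_⟩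
  -- Satake parameters of `π₁` are those of `P`; untwist to `π₀`, then to `π`
  obtain ⟨𝔫, h𝔫, hw𝔫, ϖ, hSat⟩ := hαP w hw
  have h1 : π₁.1.HasSatakeParamAt w (αP w) := (hL2 hP w (αP w)).2 ⟨𝔫, ϖ, h𝔫, hw𝔫, hSat⟩
  have h0W : π₀.1.W = π₁.1.W.map (mulChar (detTwist n χ⁻¹)) := by
    rw [h1W, detTwist_inv, map_mulChar_inv_map_mulChar]
  have h0W'' : π₀.1.W' = π₁.1.W'.map (mulChar (detTwist n χ⁻¹)) := by
    rw [h1W', h0W', Submodule.map_bot, Submodule.map_bot]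
  have h0 : π₀.1.HasSatakeParamAt w ((αP w).map (((w.residueCard : ℂ) ^ s₀) * ·)) := by
    have := AutomorphicRepData.HasSatakeParamAt.of_map_mulChar_detTwist_of_cpow (inv_apply_of_cpow hχ)
      h0W h0W'' h1
    rwa [neg_neg] at this
  have hπ : π.1.HasSatakeParamAt w ((αP w).map (((w.residueCard : ℂ) ^ s₀) * ·)) :=
    AutomorphicRepData.HasSatakeParamAt.of_compl h0W' h0inf h0sup h0
  exact ⟨fun hβ => AutomorphicRepData.hasSatakeParamAt_unique_holds π.1 hβ hπ, fun hβ => hβ ▸ hπ⟩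

/-! ### Multiset bookkeeping for the shift -/

/-- From `(c β)^{(f)} = (c' β')^{(f)}` (entrywise) with `c ≠ 0` to `β^{(f)} = ((c'/c) β')^{(f)}`.
[folklore] -/
theorem map_pow_eq_map_div_map_pow {β β' : Multiset ℂ} {c c' : ℂ} (hc : c ≠ 0) (f : ℕ)
    (h : (β.map (c * ·)).map (· ^ f) = (β'.map (c' * ·)).map (· ^ f)) :
    β.map (· ^ f) = (β'.map ((c' / c) * ·)).map (· ^ f) := by
  have hinj : Function.Injective fun x : ℂ => c ^ f * x := mul_right_injective₀ (pow_ne_zero _ hc)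
  apply Multiset.map_injective hinj
  have eL : (β.map (· ^ f)).map (fun x => c ^ f * x) = (β.map (c * ·)).map (· ^ f) := by
    simp only [Multiset.map_map, Function.comp_def, mul_pow]
  have eR : ((β'.map ((c' / c) * ·)).map (· ^ f)).map (fun x => c ^ f * x) =
      (β'.map (c' * ·)).map (· ^ f) := by
    simp only [Multiset.map_map, Function.comp_def]
    refine Multiset.map_congr rfl fun x _ => ?_
    rw [← mul_pow]
    congr 1
    field_simp
  change (β.map (· ^ f)).map (fun x => c ^ f * x) =
    ((β'.map ((c' / c) * ·)).map (· ^ f)).map (fun x => c ^ f * x)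
  rw [eL, eR]
  exact h

/-! ### The named fact from the leaves -/

/-- **Arthur–Clozel, Ch. 3, Thm. 3.1 (quadratic case, Borel–Jacquet data) from the `L²` leaves and
the unitary normalisation.** Granting, for all `GL_n` over all number fields: the automorphic
measures (`hμ`), Jacquet–Shalika (2.1)–(2.3) on the partial Rankin–Selberg `L`-functions of unitary
cuspidal representations (`h21`, `h22`, `h22'`, `h23`), multiplicity one on `L²_cusp(GL_n)` (`hm1`),
the quadratic Hecke characters `η_{M/K}` (`hQ`: for every quadratic `M/K` a Hecke character `ω` of
`K` of finite order with `ω(ϖ_w) = ε_{M/K}(w)` at almost all `w` — Arthur–Clozel p. 201: "`ζ_v =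
η(ϖ_v)` … is a root of unity of order `f_v`"; supplied unconditionally by
`exists_heckeCharacter_quadraticSign_of_finrank_eq_two`, or from Artin reciprocity by
`exists_heckeCharacter_quadraticSign`), and **"We may assume `π, π'` unitary"** (`hN`: every
cuspidal Borel–Jacquet datum `π` on `GL_n(𝔸_K)`, `n ≥ 1`, has at almost every place exactly the
Satake parameters `q_w^{s} t_{P,w}` of a complex shift of a cuspidal `P ⊂ L²_cusp(GL_n(K) A_G \
GL_n(𝔸_K))` — Borel–Jacquet 1979, 5.7; supplied from the Borel–Jacquet dictionary by
`CuspidalAutomorphicRepData.exists_satake_eq_cpow_mul_L2` or, with the true clean-model input, by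
`CuspidalAutomorphicRepData.exists_satake_eq_cpow_mul_L2_of_clean` of `LanglandsTetrahedralProofs`):
if `π, π'` are cuspidal automorphic representations of `GL_n(𝔸_K)` (arbitrary central characters)
with `t_{π,w}^{f(x|w)} = t_{π',w}^{f(x|w)}` for almost all places `x` of the quadratic extension `M`
of `K`, then either `t_{π'} = t_{π}` almost everywhere or `t_{π',w} = ε_{M/K}(w) t_{π,w}` almost
everywhere — the named fact `ArthurClozel_fibres_quadratic` of `TunnellLemma`. Proof: normalise
`t_π = q^{s} t_P`, `t_{π'} = q^{s'} t_{P'}` (`hN`), `re s = re s'` (`re_eq_zero_of_map_pow_eq_shift`,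
unitarity of central characters `|∏ t_P| = 1`), and the `L²` theorem up to the unitary shift
`q^{i im(s'-s)}` (`ArthurClozel_fibres_quadratic_L2_of_shift_of_character`: the shift vanishes and
`t_{P'} ∈ {t_P, ε t_P}` a.e.); `n = 0` is immediate. [cite: ArthurClozelAMS120, Ch. 3, Thm. 3.1] -/
theorem ArthurClozel_fibres_quadratic_of_normalisation
    (hμ : ∀ (n : ℕ) (K : Type) [Field K] [NumberField K], exists_isAutomorphicMeasure_gl n K)
    (h21 : ∀ {n : ℕ} {K : Type} [Field K] [NumberField K] {μ : Measure (gl n K).automorphicQuotient}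
      [(gl n K).IsAutomorphicMeasure μ],
      JacquetShalika1981_multipliable_partialPairL (n := n) (m := n) (K := K) (μ := μ) (μ' := μ))
    (h22 : ∀ {n : ℕ} {K : Type} [Field K] [NumberField K] {μ : Measure (gl n K).automorphicQuotient}
      [(gl n K).IsAutomorphicMeasure μ],
      JacquetShalika1981_partialPairL_at_one_of_ne_conj (n := n) (K := K) (μ := μ))
    (h22' : ∀ {n : ℕ} {K : Type} [Field K] [NumberField K] {μ : Measure (gl n K).automorphicQuotient}
      [(gl n K).IsAutomorphicMeasure μ],
      JacquetShalika1981_partialPairL_boundary_of_ne_one (n := n) (m := n) (K := K) (μ := μ) (μ' := μ))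
    (h23 : ∀ {n : ℕ} {K : Type} [Field K] [NumberField K] {μ : Measure (gl n K).automorphicQuotient}
      [(gl n K).IsAutomorphicMeasure μ],
      JacquetShalika1981_partialPairL_pole_of_eq_conj (n := n) (K := K) (μ := μ))
    (hm1 : ∀ (n : ℕ) (K : Type) [Field K] [NumberField K] (μ : Measure (gl n K).automorphicQuotient)
      [(gl n K).IsAutomorphicMeasure μ], multiplicity_one_gl n K μ)
    (hQ : ∀ {K M : Type} [Field K] [NumberField K] [Field M] [NumberField M] [Algebra K M],
      Module.finrank K M = 2 → ∃ ω : HeckeCharacter K, ω.IsFiniteOrder ∧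
        ∀ᶠ w : HeightOneSpectrum (𝓞 K) in cofinite, ω.valueAtUniformizer w = quadraticSign M w)
    (hN : ∀ {n : ℕ} {K : Type} [Field K] [NumberField K] [NeZero n]
      (hK : isCompact_glFiniteIntegralLevel n K) (μ : Measure (gl n K).automorphicQuotient)
      [(gl n K).IsAutomorphicMeasure μ] (π : CuspidalAutomorphicRepData n K hK),
      ∃ (s : ℂ) (P : CuspidalAutomorphicRepGL n K μ) (S : Set (HeightOneSpectrum (𝓞 K)))
        (αP : SatakeFamily K), S.Finite ∧ IsSatakeFamilyOf P S αP ∧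
        ∀ w ∉ S, ∀ β : Multiset ℂ,
          π.1.HasSatakeParamAt w β ↔ β = (αP w).map (((w.residueCard : ℂ) ^ s) * ·)) :
    ArthurClozel_fibres_quadratic := by
  intro n K M _ _ _ _ _ hKM hK π π' hyp
  rcases Nat.eq_zero_or_pos n with hn0 | hn
  · -- `GL_0`: all Satake parameters are the empty multiset
    subst hn0
    left
    filter_upwards [AutomorphicRepData.hasSatakeParamAt_cofinite_holds π'.1] with w hw α hα
    obtain ⟨α', hα'⟩ := hw
    have h1 : α = 0 := Multiset.card_eq_zero.1 hα.card_eq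
    have h2 : α' = 0 := Multiset.card_eq_zero.1 hα'.card_eq
    rw [h1, ← h2]
    exact hα'
  haveI : NeZero n := ⟨hn.ne'⟩
  obtain ⟨μm, hμm⟩ := hμ n K
  haveI := hμm
  -- unitary normalisations of `π` and `π'`
  obtain ⟨s, P, S, αP, hS, hαP, hiff⟩ := hN hK μm π
  obtain ⟨s', P', S', αP', hS', hαP', hiff'⟩ := hN hK μm π'
  -- the exceptional places
  set E : Set (HeightOneSpectrum (𝓞 M)) := {x | ¬ ∀ (w : HeightOneSpectrum (𝓞 K)) (α α' : Multiset ℂ),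
      x.asIdeal.under (𝓞 K) = w.asIdeal → π.1.HasSatakeParamAt w α → π'.1.HasSatakeParamAt w α' →
        α.map (· ^ x.asIdeal.inertiaDeg (𝓞 K)) = α'.map (· ^ x.asIdeal.inertiaDeg (𝓞 K))} with hE
  have hEfin : E.Finite := Filter.eventually_cofinite.1 hyp
  set T : Set (HeightOneSpectrum (𝓞 K)) := S ∪ S' ∪ ((fun x : HeightOneSpectrum (𝓞 M) => x.under (𝓞 K)) '' E)
    with hT
  have hTfin : T.Finite := (hS.union hS').union (hEfin.image _)
  have hST : S ⊆ T := fun w hw => Or.inl (Or.inl hw)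
  have hS'T : S' ⊆ T := fun w hw => Or.inl (Or.inr hw)
  -- the shifted relation `α_P(w)^{(f)} = (q^{s'-s} α_{P'}(w))^{(f)}` for all `x ∣ w ∉ T`
  have hrel0 : ∀ w ∉ T, ∀ x : HeightOneSpectrum (𝓞 M), x.asIdeal.under (𝓞 K) = w.asIdeal →
      (αP w).map (· ^ x.asIdeal.inertiaDeg (𝓞 K)) =
        ((αP' w).map (((w.residueCard : ℂ) ^ (s' - s)) * ·)).map (· ^ x.asIdeal.inertiaDeg (𝓞 K)) := by
    intro w hw x hx
    have hxE : x ∉ E := fun hxE => hw (Or.inr ⟨x, hxE, HeightOneSpectrum.ext hx⟩)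
    simp only [hE, Set.mem_setOf_eq, not_not] at hxE
    have hq : (w.residueCard : ℂ) ≠ 0 := by
      have := w.one_lt_residueCard; exact_mod_cast (by omega : w.residueCard ≠ 0)
    have h := hxE w _ _ hx ((hiff w (fun h => hw (hST h)) _).2 rfl) ((hiff' w (fun h => hw (hS'T h)) _).2 rfl)
    have hcne : (w.residueCard : ℂ) ^ s ≠ 0 := fun h0 => hq ((Complex.cpow_eq_zero_iff _ _).1 h0).1
    have h' := map_pow_eq_map_div_map_pow hcne _ h
    rwa [← Complex.cpow_sub _ _ hq] at h'
  -- if every place is exceptional there is nothing to prove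
  by_cases hex : ∃ w₀, w₀ ∉ T
  swap
  · simp only [not_exists, not_not] at hex
    left
    exact Filter.eventually_cofinite.2 (hTfin.subset fun w _ => hex w)
  -- `re s = re s'`: unitarity of the central characters of `P`, `P'` at one place
  obtain ⟨w₀, hw₀⟩ := hex
  obtain ⟨x₀, hx₀⟩ := exists_above (E := M) w₀
  have hre : (s' - s).re = 0 := by
    have hrel := hrel0 w₀ hw₀ x₀ hx₀
    obtain ⟨𝔫, -, -, ϖ, hSat⟩ := hαP w₀ (fun h => hw₀ (hST h))
    obtain ⟨𝔫', -, -, ϖ', hSat'⟩ := hαP' w₀ (fun h => hw₀ (hS'T h))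
    have hf : 0 < x₀.asIdeal.inertiaDeg (𝓞 K) := by
      rcases inertiaDeg_eq_one_or_two_of_finrank_eq_two hKM w₀ x₀ hx₀ with h | h <;> omega
    refine re_eq_zero_of_map_pow_eq_shift w₀.one_lt_residueCard hf ?_ hSat.norm_prod_eq_one
      hSat'.norm_prod_eq_one hrel
    rw [hSat'.card_eq]; exact NeZero.ne n
  set τ : ℝ := (s' - s).im with hτ
  have hsτ : s' - s = (τ : ℂ) * Complex.I := by
    apply Complex.ext
    · simp [hre]
    · simp [hτ]
  -- the `L²` theorem up to the unitary shift `q^{iτ}`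
  have hrel : ∀ w ∉ T, ∀ x : HeightOneSpectrum (𝓞 M), x.asIdeal.under (𝓞 K) = w.asIdeal →
      (αP w).map (· ^ x.asIdeal.inertiaDeg (𝓞 K)) =
        ((αP' w).map (((w.residueCard : ℂ) ^ ((τ : ℂ) * Complex.I)) * ·)).map
          (· ^ x.asIdeal.inertiaDeg (𝓞 K)) := by
    intro w hw x hx; rw [← hsτ]; exact hrel0 w hw x hx
  obtain ⟨ω, hωfin, hωM⟩ := hQ hKM
  obtain ⟨hτ0, T', hT'fin, hTT', hdich⟩ := ArthurClozel_fibres_quadratic_L2_of_shift_of_character hn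
    h21 h22 h22' h23 (hm1 n K μm) hKM ω hωfin hωM P P' hTfin (hαP.mono hST) (hαP'.mono hS'T) τ hrel
  -- hence `s' = s`
  have hss : s' = s := by
    have : s' - s = 0 := by rw [hsτ, hτ0, Complex.ofReal_zero, zero_mul]
    exact sub_eq_zero.1 this
  have hnotT' : ∀ᶠ w : HeightOneSpectrum (𝓞 K) in cofinite, w ∉ T' := by
    rw [Filter.eventually_cofinite]
    simpa using hT'fin
  -- transport back to the Borel–Jacquet data
  rcases hdich with hA' | hB'
  · left
    filter_upwards [hnotT'] with w hw β hβ
    have hwS : w ∉ S := fun h => hw (hTT' (hST h))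
    have hwS' : w ∉ S' := fun h => hw (hTT' (hS'T h))
    rw [(hiff w hwS β).1 hβ]
    exact (hiff' w hwS' _).2 (by rw [hA' w hw, hss])
  · right
    filter_upwards [hnotT'] with w hw β hβ
    have hwS : w ∉ S := fun h => hw (hTT' (hST h))
    have hwS' : w ∉ S' := fun h => hw (hTT' (hS'T h))
    rw [(hiff w hwS β).1 hβ]
    refine (hiff' w hwS' _).2 ?_
    rw [hB' w hw, hss, Multiset.map_map, Multiset.map_map]
    exact Multiset.map_congr rfl fun a _ => by simp only [Function.comp_apply]; ring

/-- **Arthur–Clozel, Ch. 3, Thm. 3.1 (quadratic case, Borel–Jacquet data): the named fact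
`ArthurClozel_fibres_quadratic` of `TunnellLemma` from the standard leaves.** Granting, for all
`GL_n` over all number fields: Jacquet–Shalika (2.1)–(2.3) on the partial Rankin–Selberg
`L`-functions of unitary cuspidal representations (`h21`, `h22`, `h22'`, `h23`), multiplicity one on
`L²_cusp(GL_n)` (`hm1`), Artin reciprocity for characters (`hR`), and the Borel–Jacquet dictionary
between cuspidal data and `L²_cusp` (existence of the automorphic measure `hμ`, association with `L²`
of `A_G`-invariant cuspidal data `hA`, agreement of Satake parameters `hL2`, realisation on a
subspace `hcl`): if `π, π'` are cuspidal automorphic representations of `GL_n(𝔸_K)` (arbitrary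
central characters) with `t_{π,w}^{f(x|w)} = t_{π',w}^{f(x|w)}` for almost all places `x` of the
quadratic extension `M` of `K`, then either `t_{π'} = t_{π}` almost everywhere or
`t_{π',w} = ε_{M/K}(w) t_{π,w}` almost everywhere. Proof: "We may assume `π, π'` unitary"
(`CuspidalAutomorphicRepData.exists_satake_eq_cpow_mul_L2`: `t_π = q^{s} t_P`, `t_{π'} = q^{s'} t_{P'}`
with `P, P'` in `L²_cusp`), `re s = re s'` (`re_eq_zero_of_map_pow_eq_shift`, unitarity of central
characters `|∏ t_P| = 1`), and the `L²` theorem up to the unitary shift `q^{i im(s'-s)}`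
(`ArthurClozel_fibres_quadratic_L2_of_shift`: the shift vanishes and `t_{P'} ∈ {t_P, ε t_P}` a.e.);
`n = 0` is immediate. By `ArthurClozel_fibres_quadratic_of_normalisation`. **Caveat.** The family hypothesis
`hcl` (`cuspidal_W'_eq_bot` for all `GL_n`: a stable *complement* of `W'`) is refuted in the tree
(`not_forall_cuspidal_W'_eq_bot` of `AutomorphicRepsGLLogDetCounterexample`: `log |det|_𝔸 · φ₀`), so
this form is vacuous; the live reductions are `ArthurClozel_fibres_quadratic_of_normalisation` and
`ArthurClozel_fibres_quadratic_of_leaves'` (`ArthurClozelFibresHolds`, clean-model input in the weak,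
true form). [cite: ArthurClozelAMS120, Ch. 3, Thm. 3.1] -/
theorem ArthurClozel_fibres_quadratic_of_leaves
    (hμ : ∀ (n : ℕ) (K : Type) [Field K] [NumberField K], exists_isAutomorphicMeasure_gl n K)
    (h21 : ∀ {n : ℕ} {K : Type} [Field K] [NumberField K] {μ : Measure (gl n K).automorphicQuotient}
      [(gl n K).IsAutomorphicMeasure μ],
      JacquetShalika1981_multipliable_partialPairL (n := n) (m := n) (K := K) (μ := μ) (μ' := μ))
    (h22 : ∀ {n : ℕ} {K : Type} [Field K] [NumberField K] {μ : Measure (gl n K).automorphicQuotient}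
      [(gl n K).IsAutomorphicMeasure μ],
      JacquetShalika1981_partialPairL_at_one_of_ne_conj (n := n) (K := K) (μ := μ))
    (h22' : ∀ {n : ℕ} {K : Type} [Field K] [NumberField K] {μ : Measure (gl n K).automorphicQuotient}
      [(gl n K).IsAutomorphicMeasure μ],
      JacquetShalika1981_partialPairL_boundary_of_ne_one (n := n) (m := n) (K := K) (μ := μ) (μ' := μ))
    (h23 : ∀ {n : ℕ} {K : Type} [Field K] [NumberField K] {μ : Measure (gl n K).automorphicQuotient}
      [(gl n K).IsAutomorphicMeasure μ],
      JacquetShalika1981_partialPairL_pole_of_eq_conj (n := n) (K := K) (μ := μ))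
    (hm1 : ∀ (n : ℕ) (K : Type) [Field K] [NumberField K] (μ : Measure (gl n K).automorphicQuotient)
      [(gl n K).IsAutomorphicMeasure μ], multiplicity_one_gl n K μ)
    (hR : GaloisRepresentations.artinReciprocity_character)
    (hA : ∀ {n : ℕ} {K : Type} [Field K] [NumberField K] (hK : isCompact_glFiniteIntegralLevel n K)
      (μ : Measure (gl n K).automorphicQuotient) [(gl n K).IsAutomorphicMeasure μ],
      AutomorphicRepsGL.exists_isAssociatedL2 hK μ)
    (hL2 : ∀ {n : ℕ} {K : Type} [Field K] [NumberField K] (hK : isCompact_glFiniteIntegralLevel n K)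
      (μ : Measure (gl n K).automorphicQuotient) [(gl n K).IsAutomorphicMeasure μ],
      hasSatakeParamAt_iff_L2 hK μ)
    (hcl : ∀ {n : ℕ} {K : Type} [Field K] [NumberField K] (hK : isCompact_glFiniteIntegralLevel n K),
      cuspidal_W'_eq_bot hK) :
    ArthurClozel_fibres_quadratic :=
  ArthurClozel_fibres_quadratic_of_normalisation hμ h21 h22 h22' h23 hm1
    (fun {K M} _ _ _ _ _ hKM => by
      obtain ⟨ω, hωfin, hω⟩ := exists_heckeCharacter_quadraticSign hR K M hKM
      exact ⟨ω, hωfin, hω.mono fun w hw => hw.2⟩)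
    (fun hK μ _ π => CuspidalAutomorphicRepData.exists_satake_eq_cpow_mul_L2 (hA hK μ) (hL2 hK μ)
      (hcl hK) π)

end Literature.NumberTheory.Automorphic
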